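import Mathlib
import Summits.Ventures.PercRepro.TriangleCapBandFull
import Summits.Ventures.PercRepro.TriangleCapRowBandsAll

/-!
# PercRepro — THE MIDDLE REGIME IS ALWAYS AN INTERVAL, AND THE BAND ON `n` VERTICES IS AN INTERVAL IFF `ℓ ≥ t − 2`,
EVERY `ℓ` (p3, gen 53; part 273)

Part 251 proved the interval property of the middle regime `t + 1 ≤ ℓ ≤ 2 t` only for `3 t ≤ 2 ℓ + 2`.  Here it is
proved for the whole regime: below `C(t, 2)` the sub-band witnesses of part 272 with `k = ℓ − 1 − (t − u)` carriers
fill `[B(u), B(u) + C(u + 1, 2) + (t − u)]` (`subband_fill`: the `t − u` star ends may all be non-leaves once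
`ℓ ≥ t + 1`), consecutive sub-bands overlap (`t − 2 u − 2 ≤ t − u`) up to `⌊t/2⌋`, the deep chain of part 268 runs
up to `u_b = t − 1` whose top is `C(t, 2)` (`coll (t − 1) (lfRR (ℓ − 1) 0) = 0`, `coll_lfRR_zero_of_le`), and above
`C(t, 2)` THE MATCHING WITNESS (`matchingWitness`: `t` disjoint off-edges, `m ≤ ℓ − t` of them inside the
non-neighbourhood, `2 j = t (t − 1) + 2 m`) reaches the extremal value `C(t, 2) + ℓ − t` (`band_full_middle`).

With parts 249 (`ℓ ≥ 2 t`: the full band), 272 (`t − 2 ≤ ℓ ≤ t`) and 253 (the first gap): **THE BAND `t` ON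
`ℓ + 1 + (s − t)` VERTICES IS AN INTERVAL — every `j` below the extremal value of part 247 attained — IFF `t ≤ ℓ + 2`**
(`band_interval_iff_all`, every `2 ≤ ℓ`, `1 ≤ t`, `2 t ≤ s`).  Axioms: standard.
-/

namespace PercRepro

namespace TriangleCap

namespace C047

open Finset

/-- The round-robin over `k ≥ u` carriers has no collision: `coll u (lfRR k 0) = 0` for `u ≤ k`. -/
theorem coll_lfRR_zero_of_le (k u : ℕ) (hu : u ≤ k) : coll u (lfRR k 0) = 0 := by
  apply coll_eq_zero_of_injOn
  intro i i' hi hi' h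
  unfold lfRR at h
  rw [if_neg (by omega), if_neg (by omega), Nat.mod_eq_of_lt (by omega), Nat.mod_eq_of_lt (by omega)] at h
  omega

/-- **THE FILLED SUB-BAND:** for `1 ≤ u`, `2 u ≤ t`, `t + 1 ≤ ℓ`, `2 t ≤ s`, every `j` with `u (t − u − 1) ≤ j` and
`2 j ≤ 2 u (t − u − 1) + u (u + 1) + 2 (t − u)` is attained on `ℓ + 1 + (s − t)` vertices (`k = ℓ − 1 − (t − u)`
carriers, all `t − u` star ends available as non-leaves). -/
theorem subband_fill (ℓ s t u j : ℕ) (hu : 1 ≤ u) (hut : 2 * u ≤ t) (hℓ : t + 1 ≤ ℓ) (hs : 2 * t ≤ s)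
    (hj1 : u * (t - u - 1) ≤ j) (hj2 : 2 * j ≤ 2 * (u * (t - u - 1)) + u * (u + 1) + 2 * (t - u)) :
    ∃ (H : SimpleGraph (Fin (ℓ + 1 + (s - t)))) (_ : DecidableRel H.Adj), H.CliqueFree 3 ∧
      H.edgeFinset.card = s ∧ (∃ w, deg H w + t = s) ∧
      ∑ v, deg H v * deg H v + 2 * (t * (s - t - 1)) + 2 * j = s * (s + 1) := by
  apply subband_interval' ℓ s t u (ℓ - 1 - (t - u)) j (by omega) (by omega) hu hut (by omega) hs hj1
  rw [coll_lfRR_zero_of_le (ℓ - 1 - (t - u)) u (by omega)]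
  have e : ℓ - 1 - (ℓ - 1 - (t - u)) = t - u := by omega
  rw [e]
  omega

/-- The left ends of the matching witness: `1 + i`. -/
def lfMatch (i : ℕ) : ℕ := 1 + i

/-- The right ends of the matching witness: the first `m` at non-leaves `s + 1 + i`, the rest at fresh leaves. -/
def rfMatch (s t m i : ℕ) : ℕ := if i < m then s + 1 + i else t + 1 + (i - m)

/-- **THE MATCHING WITNESS:** for `1 ≤ t`, `2 t ≤ s`, `m ≤ t`, `t + m ≤ ℓ`, the value `2 j = t (t − 1) + 2 m` (`t`
disjoint off-edges, `m` of them inside the non-neighbourhood) is attained on `ℓ + 1 + (s − t)` vertices. -/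
theorem matchingWitness (ℓ s t m : ℕ) (ht : 1 ≤ t) (hs : 2 * t ≤ s) (hmt : m ≤ t) (hm : t + m ≤ ℓ) :
    ∃ (H : SimpleGraph (Fin (ℓ + 1 + (s - t)))) (_ : DecidableRel H.Adj), H.CliqueFree 3 ∧
      H.edgeFinset.card = s ∧ (∃ w, deg H w + t = s) ∧
      ∑ v, deg H v * deg H v + 2 * (t * (s - t - 1)) + (t * (t - 1) + 2 * m) = s * (s + 1) := by
  set n := ℓ + 1 + (s - t) with hn
  have hn0 : 0 < n := by omega
  have hg : GoodEnds n (t + 1) t lfMatch (rfMatch s t m) := by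
    refine ⟨fun i hi => ?_, fun i hi => ?_, fun i i' hi hi' h1 _ => ?_⟩
    · unfold lfMatch
      omega
    · unfold rfMatch
      split_ifs <;> omega
    · unfold lfMatch at h1
      omega
  have hval := genWitness_missing_value n (t + 1) s t hn0 lfMatch (rfMatch s t m) hg (by omega) ht (by omega)
    (by omega)
  have hatt : ((range t).filter (fun i => rfMatch s t m i < t + 1 + (s - t))).card = t - m := by
    have : (range t).filter (fun i => rfMatch s t m i < t + 1 + (s - t)) = Ico m t := by
      ext i
      simp only [mem_filter, mem_range, mem_Ico]
      unfold rfMatch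
      constructor
      · rintro ⟨hi, hlt⟩
        split_ifs at hlt <;> omega
      · rintro ⟨hi1, hi2⟩
        refine ⟨hi2, ?_⟩
        rw [if_neg (by omega)]
        omega
    rw [this, Nat.card_Ico]
  have hcl : coll t lfMatch = 0 := by
    apply coll_eq_zero_of_injOn
    intro i i' _ _ h
    unfold lfMatch at h
    omega
  have hcr : coll t (rfMatch s t m) = 0 := by
    apply coll_eq_zero_of_injOn
    intro i i' hi hi' h
    unfold rfMatch at h
    split_ifs at h <;> omega
  rw [hatt, hcl, hcr] at hval
  refine ⟨_, inferInstance, cliqueFree_of_bipSub _ _ (bipSub_missingGraph _ _),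
    card_edges_missingGraph_genWitness n (t + 1) s t hn0 lfMatch (rfMatch s t m) hg (by omega) (by omega)
      (by omega),
    ⟨fin' n hn0 0, by
      rw [deg_missingGraph_genWitness_zero n (t + 1) s t hn0 lfMatch (rfMatch s t m) hg (by omega) (by omega)]
      omega⟩, ?_⟩
  have e1 : t - (t - m) = m := by omega
  have e2 : t * (t - 1) - (0 + 0) = t * (t - 1) := by omega
  rw [e1, e2] at hval
  have e3 : t * (t - 1) + 2 * m = 2 * m + t * (t - 1) := by ring
  rw [e3]
  exact hval

/-- **THE MIDDLE REGIME IS AN INTERVAL:** for `1 ≤ t`, `t + 1 ≤ ℓ ≤ 2 t`, `2 t ≤ s`, every `j` with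
`2 j + 2 t ≤ t (t − 1) + 2 ℓ` (the extremal bound of part 247) is attained on `ℓ + 1 + (s − t)` vertices. -/
theorem band_full_middle (ℓ s t : ℕ) (ht : 1 ≤ t) (hℓ1 : t + 1 ≤ ℓ) (hℓ2 : ℓ ≤ 2 * t) (hs : 2 * t ≤ s) :
    ∀ j, 2 * j + 2 * t ≤ t * (t - 1) + 2 * ℓ →
      ∃ (H : SimpleGraph (Fin (ℓ + 1 + (s - t)))) (_ : DecidableRel H.Adj), H.CliqueFree 3 ∧
        H.edgeFinset.card = s ∧ (∃ w, deg H w + t = s) ∧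
        ∑ v, deg H v * deg H v + 2 * (t * (s - t - 1)) + 2 * j = s * (s + 1) := by
  intro j hj
  rcases Nat.lt_or_ge t 2 with ht1 | ht2
  · -- `t = 1`, `ℓ = 2`: the star witness
    obtain rfl : t = 1 := by omega
    norm_num at hj
    exact starWitness ℓ s 1 j ht hs (by omega) (by omega)
  rcases Nat.lt_or_ge (t * (t - 1)) (2 * j) with hbig | hsmall
  · -- above `C(t, 2)`: the matching witness with `m = j − C(t, 2)` inside edges
    obtain ⟨x, hx⟩ := Nat.even_mul_pred_self t
    have hw := matchingWitness ℓ s t (j - x) ht hs (by omega) (by omega)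
    have e : t * (t - 1) + 2 * (j - x) = 2 * j := by omega
    rw [e] at hw
    exact hw
  · -- at most `C(t, 2)`: the filled sub-bands up to `⌊t/2⌋`, then the deep chain up to `u_b = t − 1`
    by_cases hcase : 2 * j ≤ deepTop t (ℓ - 1) (t / 2)
    · -- the chain of filled sub-bands from the star
      have hchain := chain_attained (fun j => ∃ (H : SimpleGraph (Fin (ℓ + 1 + (s - t)))) (_ : DecidableRel H.Adj),
          H.CliqueFree 3 ∧ H.edgeFinset.card = s ∧ (∃ w, deg H w + t = s) ∧
          ∑ v, deg H v * deg H v + 2 * (t * (s - t - 1)) + 2 * j = s * (s + 1))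
        (fun u => u * (t - u - 1)) (fun u => u * (t - u - 1) + (u * (u + 1)) / 2 + (t - u)) 0 (t / 2)
        (Nat.zero_le _) ?_ ?_ j (by omega) ?_
      · exact hchain
      · intro u _ hu2 j hj1 hj2
        rcases Nat.eq_zero_or_pos u with rfl | hu0
        · -- the star with `j ≤ t` non-leaf ends
          exact starWitness ℓ s t j ht hs (by omega) (by omega)
        · obtain ⟨y, hy⟩ := Nat.even_mul_succ_self u
          exact subband_fill ℓ s t u j hu0 (by omega) hℓ1 hs hj1 (by omega)
      · intro u _ hu2
        have e : t - (u + 1) - 1 = t - u - 2 := by omega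
        rw [e]
        rcases Nat.lt_or_ge t (u + 2) with hlt | hge
        · have e' : t - u - 2 = 0 := by omega
          rw [e', mul_zero]
          exact Nat.zero_le _
        · obtain ⟨d, rfl⟩ : ∃ d, t = u + 2 + d := ⟨t - u - 2, by omega⟩
          have e1 : u + 2 + d - u - 2 = d := by omega
          have e2 : u + 2 + d - u - 1 = d + 1 := by omega
          have e3 : u + 2 + d - u = d + 2 := by omega
          rw [e1, e2, e3]
          have f : (u + 1) * d ≤ u * (d + 1) + d + 2 := by nlinarith
          omega
      · -- `2 j ≤ deepTop (t/2)`, and the chain's top at `t/2` is at least `deepTop (t/2) / 2`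
        have hD : deepTop t (ℓ - 1) (t / 2) ≤ 2 * ((t / 2) * (t - t / 2 - 1)) + (t / 2) * (t / 2 + 1) := by
          unfold deepTop
          omega
        obtain ⟨y, hy⟩ := Nat.even_mul_succ_self (t / 2)
        omega
    · -- the deep chain from `⌊t/2⌋` to `t − 1`, whose top is `t (t − 1)`
      have htop : deepTop t (ℓ - 1) (t - 1) = t * (t - 1) := by
        unfold deepTop
        rw [coll_lfRR_zero_of_le (ℓ - 1) (t - 1) (by omega)]
        have e1 : t - (t - 1) - 1 = 0 := by omega
        rw [e1, mul_zero, mul_zero, zero_add, Nat.sub_zero, Nat.sub_add_cancel ht, mul_comm]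
      exact deep_top_attained ℓ s t (t / 2) (t - 1) (by omega) (by omega) (by omega) (by omega) (by omega) hs j
        (by omega) (by omega)

/-- **THE BAND ON `n` VERTICES IS AN INTERVAL IFF `ℓ ≥ t − 2`, EVERY `ℓ`:** for `2 ≤ ℓ`, `1 ≤ t`, `2 t ≤ s`, every `j`
satisfying the three extremal bounds of part 247 (`2 j ≤ t (t + 1)`; `2 j + 2 t ≤ t (t − 1) + 2 ℓ` when `t ≤ ℓ`;
`2 j + 2 (t / ℓ) t ≤ t (t − 1) + ℓ (t / ℓ)(t / ℓ + 1)` when `ℓ ≤ t`) is attained on `ℓ + 1 + (s − t)` vertices IFF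
`t ≤ ℓ + 2`. -/
theorem band_interval_iff_all (ℓ s t : ℕ) (hℓ : 2 ≤ ℓ) (ht : 1 ≤ t) (hs : 2 * t ≤ s) :
    (∀ j, 2 * j ≤ t * (t + 1) → (t ≤ ℓ → 2 * j + 2 * t ≤ t * (t - 1) + 2 * ℓ) →
      (ℓ ≤ t → 2 * j + 2 * (t / ℓ) * t ≤ t * (t - 1) + ℓ * ((t / ℓ) * (t / ℓ + 1))) →
      ∃ (H : SimpleGraph (Fin (ℓ + 1 + (s - t)))) (_ : DecidableRel H.Adj), H.CliqueFree 3 ∧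
        H.edgeFinset.card = s ∧ (∃ w, deg H w + t = s) ∧
        ∑ v, deg H v * deg H v + 2 * (t * (s - t - 1)) + 2 * j = s * (s + 1)) ↔ t ≤ ℓ + 2 := by
  constructor
  · intro hall
    by_contra hlt
    -- `ℓ + 3 ≤ t`: the value `j = ℓ` satisfies the bounds but is the first gap
    have hb := (band_interval_iff ℓ s t hℓ (by omega) hs)
    -- the extremal bound at `j = ℓ`, from the attained value `t − 2`
    obtain ⟨H, _, hfree, hs', ⟨w, hw⟩, hj'⟩ := subband_attained' ℓ s t 1 (t - 2) hℓ le_rfl (by omega) (by omega) hs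
      (by omega) (by omega)
    have hx := (vertex_band_extremal ℓ s t (by omega) ht hs).1 H hfree hs' w hw (t - 2) hj'
    have hatt := hall ℓ (by omega) (fun h => by omega) (fun _ => by have := hx.2.2 (by omega); omega)
    exact first_gap_not_attained ℓ s t ℓ ht hs le_rfl (by omega) hatt
  · intro h j hj1 hj2 hj3
    rcases Nat.lt_or_ge t ℓ with hlt | hge
    · rcases Nat.lt_or_ge (2 * t) ℓ with h2 | h2
      · -- `ℓ > 2 t`: the full band
        exact vertex_band_full_interval (ℓ + 1 + (s - t)) s t j ht hs (by omega) hj1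
      · -- `t + 1 ≤ ℓ ≤ 2 t`: the middle regime
        exact band_full_middle ℓ s t ht hlt h2 hs j (hj2 (by omega))
    · -- `ℓ ≤ t ≤ ℓ + 2`
      exact band_full_of_le ℓ s t hℓ hge h hs j (hj3 hge)

end C047

end TriangleCap

end PercRepro
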